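import Literature.NumberTheory.Automorphic.Liu2021.LemD1AsPrintedIndexedNonVacuityInertCofinite
import Literature.NumberTheory.Automorphic.Liu2021.LemD1AsPrintedIndexedNonVacuityNonsplitPlace
import Literature.NumberTheory.Automorphic.Liu2021.LemD1DataOfPlace
import Literature.NumberTheory.Automorphic.AdicCompletionDegreeOnePlaceEquiv
import Mathlib.NumberTheory.RamificationInertia.Galois
import HarnessLib

/-!
# [Liu2021, App. D §D.1 Step 2 ∕ Lemma D.1 (3)] — the place model at a RAMIFIED non-split place: `e = 2`, `f = 1`, a NORM
# uniformiser, and EVERY Step-2 datum is RAMIFIED; the CM rows' `ψ` is ramified at every place of `L` ramified over `L⁺`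

Reproduction ∕ bookkeeping (Literature, THEOREMS ONLY: no definition, no record, no named fact, no `sorry`; nothing is
asserted about Liu's oscillator representations or about the tree's constructed local Weil carriers).

Sequel of `LemD1AsPrintedIndexedNonVacuityInertRigidity.lean` ∕ `…InertCofinite.lean` (INERT non-split places: an inert witness
`v_w(ι_w π) = exp(−1)` exists iff `e(w|v) = 1`; there the unramified Step-2 character is unique) and of the explicit ramified model
`…NonVacuityRamified.lean` (`ℚ₃(√3)/ℚ₃`).  This file treats the GENERAL place model (`E/F` quadratic, `E_v = UnitaryGroup.LocalRing E v`,
`c ⊗ 1 = conjLocal`) at the finitely many remaining non-split places — `w ∣ v` fixed by `c` with `e(w|v) ≠ 1`: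

* §1 (every place) norms `x · (c ⊗ 1) x` of `E_v` lie in `ι_v(F_v)` (`exists_mul_conjLocal_eq_toLocalRing`, `exists_units_mul_conjLocal_eq`);
  at a non-split `w` the valuation identity **`v_v(a)^{e(w|v)} = v_w(x_w)²`** for `x · (c ⊗ 1) x = ι_v a` (`valued_pow_ramificationIdx'_eq_sq`,
  from `…InertRigidity.valued_mul_conjLocal_apply` and tree `valued_toPlace`); norms are closed under products and powers (§1b);
* §2 **the dichotomy `e · f = 2` at a non-split place** (`ramificationIdx_mul_inertiaDeg_eq_two_of_smul_eq`: `w` is the ONLY prime above `v`,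
  Mathlib's Galois form `#{𝔓 ∣ v} · e · f = #Aut(E/F) = 2` of the fundamental identity): either `e = 1, f = 2` (INERT, `…InertCofinite`) or
  `e = 2, f = 1` (RAMIFIED); so `e(w|v) ≠ 1` means `e = 2` and `f = 1` (`ramificationIdx'_eq_two_of_ne_one`, `inertiaDeg_eq_one_of_ne_one`);
* §3 at a RAMIFIED non-split place: the norm `a = Π · (c ⊗ 1) Π` of an element `Π ∈ E_vˣ` with `v_w(Π_w) = exp(−1)` is a UNIFORMISER of
  `F_v` which IS a norm (**`exists_isNorm_valued_eq_exp_neg_one_of_ramified`** — contrast `…InertRigidity.not_isNorm_of_valued_eq`: at an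
  inert place no element of odd valuation is a norm); hence, the norms having index `2` (`…NonsplitPlace.exists_not_isNorm_of_nonsplit`),
  **some UNIT of `F_v` is NOT a norm** (`exists_unit_not_isNorm_of_ramified`: if all units were norms then so would be every
  `b = u · a^{−m}`);
* §4 consequently EVERY Step-2 datum `(μ, hμF)` of the rows' displayed binder shape «`μ(ι_v a) = 1 ↔ a ∈ Nm E_vˣ`» is RAMIFIED there:
  `μ(ι_v u) = −1` at a unit `u ∈ 𝒪_vˣ` (**`exists_unit_apply_eq_neg_one_of_ramified`** — `μ ∘ ι_v` is a ramified quadratic character of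
  `F_vˣ`), so `μ` is non-trivial on the units of `w`-valuation `1` (**`not_unramified_stepTwo_of_ramified`**; `MuSet` form
  `not_unramified_muSet_of_ramified`), while `μ(ι_v a) = 1` at the norm uniformiser (`exists_valued_eq_apply_eq_one_of_ramified` — at an inert
  place instead `μ(ι_v π) = −1` for every uniformiser, `…InertRigidity`); and the INERT-OR-RAMIFIED disjunction at an arbitrary non-split place
  (`exists_inertWitness_or_forall_stepTwo_ramified`);
* §5 the CM rows (`L` CM, `F = L⁺`, `c` = complex conjugation, `μ_v = localMu L (toHeckeCharacter L ψ) v`, binder `hψ : IsConjugateSymplectic`):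
  **`not_isUnramifiedAt_toHeckeCharacter_of_ramificationIdx'_ne_one`** — a conjugate-symplectic `ψ` is RAMIFIED at EVERY finite place `w`
  of `L` with `e(w | w ∩ L⁺) ≠ 1` (such a `w` is fixed by `c`, tree `ramificationIdx'_eq_one_of_smul_ne`; then §4 with the rows' own Step-2
  clause `localMu_toLocalRing_eq_one_iff`); the same in Mathlib's currencies `¬ Algebra.IsUnramifiedAt (𝓞 L⁺) w` and `w ∣ 𝔇_{L/L⁺}`
  (`…_of_not_isUnramifiedAt`, `…_of_dvd_differentIdeal`): **the ramification of `L/L⁺` is contained in the ramification of every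
  conjugate-symplectic Hecke character of `L`**; contrapositive `ramificationIdx'_eq_one_of_isUnramifiedAt_toHeckeCharacter`.

Picture for an auditor of the END rows `hD1''` ∕ `hD3` (our bookkeeping, not a claim about Liu's objects): at the finitely many non-split places
of `L⁺` excluded by `…InertCofinite` because `L/L⁺` ramifies there, the rows' own `μ_v` is NEVER the unramified sign character — every member's
μ-label is a ramified character, equal to `1` at a norm uniformiser of `L⁺_v`.

What this does NOT give: which ramified characters occur as `μ_v` at such a place, or whether two members' labels can differ there (they can
differ at most by a character trivial on `ι_v(F_vˣ)`); the places of `L⁺` unramified in `L` but below the ramification of `ψ`; anything about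
the rows' carriers; Lem. D.1 itself.  HC_CM is NOT proved.

v2 (APPEND-only, §§1–5 byte-identical): §6 — the CM rows' FULL local component at a non-split place `w` where `ψ` is unramified is
the unramified sign character, `ψ_w(x) = (−1)^{ord_w x}` (`localComponent_toHeckeCharacter_eq_neg_one_zpow_of_isUnramifiedAt`; hypotheses
`hw`, `hunr` only — `hunr` supplies `e = 1` by §5 and the inert witness by `…InertCofinite`); the Frobenius value
`ψ_w(ϖ_w) = HeckeCharacter.valueAtUniformizer … w = −1` (`valueAtUniformizer_toHeckeCharacter_eq_neg_one_of_isUnramifiedAt`), at all but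
finitely many non-split `w` (`eventually_valueAtUniformizer_toHeckeCharacter_eq_neg_one`); `ψ_w ≠ 1` there (order exactly `2`).

v3 (APPEND-only, §§1–6 byte-identical): §7 — explicit exceptional sets for the rows: `{w : e(w | w ∩ L⁺) ≠ 1} ⊆ ramifiedPlaces ψ` and
`{w : w ∣ 𝔇_{L/L⁺}} ⊆ ramifiedPlaces ψ` (`setOf_ramificationIdx'_ne_one_subset_ramifiedPlaces`, `setOf_dvd_differentIdeal_subset_ramifiedPlaces`);
the non-split places where the labels of `ψ, ψ'` differ lie below `ramifiedPlaces ψ ∪ ramifiedPlaces ψ'`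
(`setOf_nonsplit_localMu_ne_subset_image_ramifiedPlaces` — the finite set of `…InertCofinite.finite_nonsplit_localMu_ne` named); packaged form
`muOf_localMu_eq_of_isUnramifiedAt`.

Cell pub-hodgecm2 (COR-CM), audit class of the END rows `hD1''` ∕ `hD3`; seat prover-pub-hodgecm2-b10.

References: [Liu2021] Y. Liu, *Fourier–Jacobi cycles and arithmetic relative trace formula*, Camb. J. Math. 9 (2021) =
arXiv:2102.11518, Def. 4.1, Def. 4.11 (l. 2086), App. D §D.1 Step 2 (l. 5219), Lemma D.1 (3) (l. 5233);
[NeukirchANT1999] J. Neukirch, *Algebraic Number Theory*, Grundlehren 322 (1999), Ch. I §8 Prop. (8.2) (fundamental identity;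
«nonsplit»), Ch. II §6 (before Prop. (6.8): `v(π) = e·w(Π)`, `π = ε Π^e`), Ch. III §2 Thm. (2.6) (`𝔓` ramified iff `𝔓 ∣ 𝔇_{L|K}`);
[CasselsFrohlichANT1967] Ch. II §10 (completions of an extension), Ch. VI §1.1 (local norm index of a quadratic extension);
[Omeara1963] §63B Cor. 63:13a; [TateThesis1967] Lemma 3.2.1 (almost all local components unramified).
-/

noncomputable section

open scoped Matrix MatrixGroups
open NumberField IsDedekindDomain
open Literature.RepresentationTheory
open Literature.NumberTheory.GaloisRepresentations (HeckeCharacter localUnits)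

namespace Literature.NumberTheory.Automorphic.Liu2021.LemD1IndexedNonVacuityRamifiedPlace

open UnitaryGroup

section General

variable {F : Type} (E : Type) [Field F] [NumberField F] [Field E] [NumberField E] [Algebra F E]
  [Algebra.IsQuadraticExtension F E] (v : HeightOneSpectrum (𝓞 F)) (c : E ≃ₐ[F] E)
  {δ : E} (hcδ : c δ = -δ) (hδ : δ ≠ 0)

/-! ## §1 Norms `x · (c ⊗ 1) x` lie in `ι_v(F_v)`; at a non-split place `v_v(Nm x)^{e(w|v)} = v_w(x_w)²` -/

include hcδ hδ in
/-- an element of `E_v` fixed by `c ⊗ 1` lies in `ι_v(F_v)` (coordinates `ι_v p + ι_v q · (δ ⊗ 1)`: fixed means `2 ι_v q · (δ ⊗ 1) = 0`,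
and `2`, `δ ⊗ 1` are units). [folklore] -/
private theorem exists_eq_toLocalRing_of_conjLocal_eq (x : LocalRing E v) (hx : conjLocal E c v x = x) :
    ∃ p : v.adicCompletion F, x = toLocalRing E v p := by
  haveI : CharZero (v.adicCompletion F) := charZero_of_injective_algebraMap (algebraMap F _).injective
  obtain ⟨⟨p, q⟩, hpq, -⟩ := existsUnique_eq_add_mul E v c hcδ hδ x
  dsimp only at hpq
  have hconj : conjLocal E c v x = toLocalRing E v p - toLocalRing E v q * algebraMap E (LocalRing E v) δ := by
    rw [hpq, map_add, map_mul, conjLocal_toLocalRing, conjLocal_toLocalRing, conjLocal_algebraMap, hcδ, map_neg]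
    ring
  have h2 : toLocalRing E v 2 * (toLocalRing E v q * algebraMap E (LocalRing E v) δ) = 0 := by
    have h := hx
    rw [hconj, hpq] at h
    rw [map_ofNat]
    linear_combination -h
  have h2u : IsUnit (toLocalRing E v 2) := (isUnit_iff_ne_zero.2 (two_ne_zero : (2 : v.adicCompletion F) ≠ 0)).map _
  have hδu : IsUnit (algebraMap E (LocalRing E v) δ) := (isUnit_iff_ne_zero.2 hδ).map _
  have hq : toLocalRing E v q * algebraMap E (LocalRing E v) δ = 0 := (h2u.mul_right_eq_zero).1 h2
  rw [mul_comm] at hq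
  have hq' : toLocalRing E v q = 0 := (hδu.mul_right_eq_zero).1 hq
  exact ⟨p, by rw [hpq, hq', zero_mul, add_zero]⟩

include hcδ hδ in
/-- **norms from `E_v` lie in `ι_v(F_v)`** (every place): `x · (c ⊗ 1) x = ι_v a` for some `a ∈ F_v` — it is fixed by the involution
`c ⊗ 1` (tree `LemD1OfPlace.conjLocal_conjLocal_apply`). [cite: Liu2021, App. D §D.1 Step 2 (l. 5219)] [cite: CasselsFrohlichANT1967, Ch. II §10] -/
theorem exists_mul_conjLocal_eq_toLocalRing (x : LocalRing E v) :
    ∃ a : v.adicCompletion F, x * conjLocal E c v x = toLocalRing E v a :=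
  exists_eq_toLocalRing_of_conjLocal_eq E v c hcδ hδ _
    (by rw [map_mul, LemD1OfPlace.conjLocal_conjLocal_apply E v c hcδ hδ, mul_comm])

include hcδ hδ in
/-- **… units version**: for `x ∈ E_vˣ` the norm `x · (c ⊗ 1) x` is `ι_v a` with `a ∈ F_vˣ`. [cite: Liu2021, App. D §D.1 Step 2 (l. 5219)] -/
theorem exists_units_mul_conjLocal_eq (x : (LocalRing E v)ˣ) :
    ∃ a : (v.adicCompletion F)ˣ,
      (x : LocalRing E v) * conjLocal E c v x = algebraMap (v.adicCompletion F) (LocalRing E v) a := by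
  obtain ⟨a, ha⟩ := exists_mul_conjLocal_eq_toLocalRing E v c hcδ hδ (x : LocalRing E v)
  have ha0 : a ≠ 0 := by
    rintro rfl
    rw [map_zero] at ha
    have hu : IsUnit ((x : LocalRing E v) * conjLocal E c v x) := x.isUnit.mul (x.isUnit.map _)
    rw [ha] at hu
    exact not_isUnit_zero hu
  exact ⟨Units.mk0 a ha0, by rw [Units.val_mk0, algebraMap_localRing_eq, ha]⟩

include hcδ hδ in
/-- **`v_v(a)^{e(w|v)} = v_w(x_w)²` when `x · (c ⊗ 1) x = ι_v a` at a non-split place** (`v_w` of a norm is `v_w(x_w)²`,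
`…InertRigidity.valued_mul_conjLocal_apply`; `v_w(ι_w a) = v_v(a)^e`, tree `valued_toPlace`). [cite: NeukirchANT1999, Ch. II §6 (before Prop. 6.8)]
[cite: CasselsFrohlichANT1967, Ch. II §10] -/
theorem valued_pow_ramificationIdx'_eq_sq (w : PlacesOver E v) (hw : c • w.1 = w.1) (x : (LocalRing E v)ˣ)
    (a : (v.adicCompletion F)ˣ)
    (ha : (x : LocalRing E v) * conjLocal E c v x = algebraMap (v.adicCompletion F) (LocalRing E v) a) :
    Valued.v (a : v.adicCompletion F) ^ v.asIdeal.ramificationIdx' w.1.asIdeal = Valued.v ((x : LocalRing E v) w) ^ 2 := by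
  rw [← valued_toPlace, ← toLocalRing_apply, ← algebraMap_localRing_eq, ← ha,
    LemD1IndexedNonVacuityInertRigidity.valued_mul_conjLocal_apply E v c hcδ hδ w hw]

omit [NumberField F] [Algebra.IsQuadraticExtension F E] in
/-- `E_v = Π_{w ∣ v} E_w` has a unit ALL of whose components are uniformisers (`v_w(Π_w) = exp(−1)` for every `w ∣ v`). [folklore] -/
private theorem exists_units_forall_valued_apply_eq :
    ∃ P : (LocalRing E v)ˣ, ∀ w : PlacesOver E v, Valued.v ((P : LocalRing E v) w) = WithZero.exp (-1 : ℤ) :=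
  ⟨MulEquiv.piUnits.symm fun w' : PlacesOver E v => HeckeCharacter.uniformizer E w'.1,
    fun w => HeckeCharacter.valued_uniformizer (v := w.1)⟩

/-! ## §1b Norms form a subgroup: products and powers of norms are norms -/

omit [Algebra.IsQuadraticExtension F E] in
/-- `ι_v(a) · (c ⊗ 1)(ι_v a) = ι_v(a²)`: squares are norms (every place). [cite: Liu2021, App. D §D.1 Step 2 (l. 5219)] -/
private theorem units_map_mul_conjLocal (a : (v.adicCompletion F)ˣ) :
    ((Units.map (algebraMap (v.adicCompletion F) (LocalRing E v)).toMonoidHom a : (LocalRing E v)ˣ) : LocalRing E v) *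
        conjLocal E c v (Units.map (algebraMap (v.adicCompletion F) (LocalRing E v)).toMonoidHom a : (LocalRing E v)ˣ) =
      algebraMap (v.adicCompletion F) (LocalRing E v) ((a * a : (v.adicCompletion F)ˣ) : v.adicCompletion F) := by
  rw [Units.coe_map, RingHom.toMonoidHom_eq_coe, MonoidHom.coe_coe, algebraMap_localRing_eq, conjLocal_toLocalRing,
    Units.val_mul, map_mul]

omit [Algebra.IsQuadraticExtension F E] in
/-- the norm relation in the group of units: `x · (c ⊗ 1) x = ι_v a` iff `x · c_*(x) = ι_v(a)` in `E_vˣ`. [folklore] -/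
private theorem isNorm_iff_units (x : (LocalRing E v)ˣ) (a : (v.adicCompletion F)ˣ) :
    (x : LocalRing E v) * conjLocal E c v x = algebraMap (v.adicCompletion F) (LocalRing E v) a ↔
      x * Units.map (conjLocal E c v).toMonoidHom x = Units.map (algebraMap (v.adicCompletion F) (LocalRing E v)).toMonoidHom a := by
  rw [Units.ext_iff, Units.val_mul, Units.coe_map, Units.coe_map, RingHom.toMonoidHom_eq_coe, MonoidHom.coe_coe,
    RingHom.toMonoidHom_eq_coe, MonoidHom.coe_coe]

omit [Algebra.IsQuadraticExtension F E] in
/-- **norms are closed under `b ↦ b · a^m`** (`m ∈ ℤ`): if `a = Nm xa` and `b = Nm y` then `b · a^m = Nm (y · xa^m)` (`E_v` is commutative and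
`c ⊗ 1` multiplicative). [cite: CasselsFrohlichANT1967, Ch. VI §1.1] -/
theorem isNorm_mul_zpow {a b : (v.adicCompletion F)ˣ} {xa y : (LocalRing E v)ˣ}
    (hxa : (xa : LocalRing E v) * conjLocal E c v xa = algebraMap (v.adicCompletion F) (LocalRing E v) a)
    (hy : (y : LocalRing E v) * conjLocal E c v y = algebraMap (v.adicCompletion F) (LocalRing E v) b) (m : ℤ) :
    ((y * xa ^ m : (LocalRing E v)ˣ) : LocalRing E v) * conjLocal E c v (y * xa ^ m : (LocalRing E v)ˣ) =
      algebraMap (v.adicCompletion F) (LocalRing E v) ((b * a ^ m : (v.adicCompletion F)ˣ) : v.adicCompletion F) := by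
  rw [isNorm_iff_units] at hxa hy ⊢
  rw [map_mul, map_zpow, mul_mul_mul_comm, ← mul_zpow, hy, hxa, ← map_zpow, ← map_mul]

/-! ## §2 The dichotomy `e · f = 2` at a non-split place: inert (`e = 1`, `f = 2`) or ramified (`e = 2`, `f = 1`) -/

/-- **`e(w|v) · f(w|v) = 2` at a non-split place of the quadratic extension `E/F`**: if `c ≠ 1` fixes `w ∣ v` then `w` is the ONLY prime of
`E` above `v` (tree `PlacesOver.eq_of_smul_eq`), and the Galois form of the fundamental identity `#{𝔓 ∣ v} · e · f = #Aut(E/F) = [E : F] = 2`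
(Mathlib `Ideal.ncard_primesOver_mul_ramificationIdxIn_mul_inertiaDegIn`, `IsGalois.card_aut_eq_finrank`) reads `e · f = 2`.
[cite: NeukirchANT1999, Ch. I §8 Prop. (8.2)] -/
theorem ramificationIdx_mul_inertiaDeg_eq_two_of_smul_eq (hc : c ≠ 1) (w : PlacesOver E v) (hw : c • w.1 = w.1) :
    w.1.asIdeal.ramificationIdx (𝓞 F) * w.1.asIdeal.inertiaDeg (𝓞 F) = 2 := by
  haveI : v.asIdeal.IsMaximal := v.isMaximal
  haveI : w.1.asIdeal.LiesOver v.asIdeal := PlacesOver.liesOver w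
  haveI : IsGaloisGroup (E ≃ₐ[F] E) (𝓞 F) (𝓞 E) := IsGaloisGroup.of_isFractionRing _ _ _ F E
  have hid := Ideal.ncard_primesOver_mul_ramificationIdxIn_mul_inertiaDegIn v.asIdeal (𝓞 E) (E ≃ₐ[F] E)
  have hcard : Nat.card (E ≃ₐ[F] E) = 2 :=
    (Algebra.IsQuadraticExtension.finrank_eq_two F E) ▸ IsGalois.card_aut_eq_finrank F E
  have h1 : (v.asIdeal.primesOver (𝓞 E)).ncard = 1 := by
    rw [Set.ncard_eq_one]
    refine ⟨w.1.asIdeal, Set.eq_singleton_iff_unique_mem.2 ⟨⟨w.1.isPrime, PlacesOver.liesOver w⟩, fun P hP => ?_⟩⟩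
    obtain ⟨hPp, hPl⟩ := hP
    have hP0 : P ≠ ⊥ := Ideal.ne_bot_of_liesOver_of_ne_bot v.ne_bot P
    exact congrArg (fun u : PlacesOver E v => u.1.asIdeal)
      (PlacesOver.eq_of_smul_eq c hc w hw ⟨⟨P, hPp, hP0⟩, HeightOneSpectrum.ext hPl.over.symm⟩)
  rw [hcard, h1, one_mul, Ideal.ramificationIdxIn_eq_ramificationIdx v.asIdeal w.1.asIdeal (E ≃ₐ[F] E),
    Ideal.inertiaDegIn_eq_inertiaDeg v.asIdeal w.1.asIdeal (E ≃ₐ[F] E)] at hid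
  exact hid

/-- **… hence `(e, f) = (1, 2)` (INERT) or `(e, f) = (2, 1)` (RAMIFIED) at a non-split place.** [cite: NeukirchANT1999, Ch. I §8 Prop. (8.2)] -/
theorem ramificationIdx_inertiaDeg_dichotomy_of_smul_eq (hc : c ≠ 1) (w : PlacesOver E v) (hw : c • w.1 = w.1) :
    (w.1.asIdeal.ramificationIdx (𝓞 F) = 1 ∧ w.1.asIdeal.inertiaDeg (𝓞 F) = 2) ∨
      (w.1.asIdeal.ramificationIdx (𝓞 F) = 2 ∧ w.1.asIdeal.inertiaDeg (𝓞 F) = 1) := by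
  have h := ramificationIdx_mul_inertiaDeg_eq_two_of_smul_eq E v c hc w hw
  have hdvd : w.1.asIdeal.ramificationIdx (𝓞 F) ∣ 2 := Dvd.intro _ h
  rcases (Nat.dvd_prime Nat.prime_two).1 hdvd with he | he
  · left
    refine ⟨he, ?_⟩
    rwa [he, one_mul] at h
  · right
    refine ⟨he, ?_⟩
    rw [he] at h
    omega

omit [NumberField F] [Algebra.IsQuadraticExtension F E] in
/-- the index `e(w|v)` of the tree's `valued_toPlace` (Mathlib `Ideal.ramificationIdx'`) is Mathlib's `Ideal.ramificationIdx` for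
`𝓞 F → 𝓞 E`. [folklore] -/
private theorem ramificationIdx'_eq (w : PlacesOver E v) :
    v.asIdeal.ramificationIdx' w.1.asIdeal = w.1.asIdeal.ramificationIdx (𝓞 F) := by
  haveI : w.1.asIdeal.LiesOver v.asIdeal := PlacesOver.liesOver w
  exact Ideal.ramificationIdx'_eq_ramificationIdx v.asIdeal w.1.asIdeal v.ne_bot

/-- **at a non-split place, `e(w|v) ≠ 1` forces `e(w|v) = 2`** (the index of the tree's `valued_toPlace`: `v_w(ι_w y) = v_v(y)²` there — a
uniformiser of `F_v` has `w`-valuation `exp(−2)`, `π = ε Π²`). [cite: NeukirchANT1999, Ch. I §8 Prop. (8.2); Ch. II §6 (before Prop. 6.8)] -/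
theorem ramificationIdx'_eq_two_of_ne_one (hc : c ≠ 1) (w : PlacesOver E v) (hw : c • w.1 = w.1)
    (he : v.asIdeal.ramificationIdx' w.1.asIdeal ≠ 1) : v.asIdeal.ramificationIdx' w.1.asIdeal = 2 := by
  rw [ramificationIdx'_eq E v w] at he ⊢
  rcases ramificationIdx_inertiaDeg_dichotomy_of_smul_eq E v c hc w hw with ⟨h1, -⟩ | ⟨h2, -⟩
  · exact absurd h1 he
  · exact h2

/-- **… and `f(w|v) = 1`**: a ramified non-split place has residue degree one. [cite: NeukirchANT1999, Ch. I §8 Prop. (8.2)] -/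
theorem inertiaDeg_eq_one_of_ne_one (hc : c ≠ 1) (w : PlacesOver E v) (hw : c • w.1 = w.1)
    (he : v.asIdeal.ramificationIdx' w.1.asIdeal ≠ 1) : w.1.asIdeal.inertiaDeg (𝓞 F) = 1 := by
  rw [ramificationIdx'_eq E v w] at he
  rcases ramificationIdx_inertiaDeg_dichotomy_of_smul_eq E v c hc w hw with ⟨h1, -⟩ | ⟨-, h2⟩
  · exact absurd h1 he
  · exact h2

omit [Algebra.IsQuadraticExtension F E] in
/-- `¬ Algebra.IsUnramifiedAt (𝓞 F) w` ⟹ `e(w|v) ≠ 1` (Mathlib `Ideal.ramificationIdx_eq_one_iff`). [folklore] -/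
private theorem ramificationIdx'_ne_one_of_not_isUnramifiedAt (w : PlacesOver E v)
    (hr : ¬ Algebra.IsUnramifiedAt (𝓞 F) w.1.asIdeal) : v.asIdeal.ramificationIdx' w.1.asIdeal ≠ 1 := by
  rw [ramificationIdx'_eq E v w]
  exact fun h => hr (Ideal.ramificationIdx_eq_one_iff.mp h)

/-! ## §3 A ramified non-split place: a NORM uniformiser of `F_v`; a unit of `F_v` which is NOT a norm -/

include hcδ hδ in
/-- **at a RAMIFIED non-split place some uniformiser of `F_v` IS a norm from `E_vˣ`**: the norm `a` of an element `Π ∈ E_vˣ` with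
`v_w(Π_w) = exp(−1)` has `v_v(a)^e = v_w(Π_w)² = exp(−2)` with `e = 2`, so `v_v(a) = exp(−1)`.  (Contrast: at an INERT place no element of
odd valuation is a norm, `…InertRigidity.not_isNorm_of_valued_eq`.) [cite: NeukirchANT1999, Ch. II §6 (before Prop. 6.8)]
[cite: CasselsFrohlichANT1967, Ch. VI §1.1] -/
theorem exists_isNorm_valued_eq_exp_neg_one_of_ramified (w : PlacesOver E v) (hw : c • w.1 = w.1)
    (he : v.asIdeal.ramificationIdx' w.1.asIdeal ≠ 1) :
    ∃ a : (v.adicCompletion F)ˣ, Valued.v (a : v.adicCompletion F) = WithZero.exp (-1 : ℤ) ∧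
      ∃ x : (LocalRing E v)ˣ, (x : LocalRing E v) * conjLocal E c v x = algebraMap (v.adicCompletion F) (LocalRing E v) a := by
  have hc : c ≠ 1 := by
    rintro rfl
    rw [AlgEquiv.one_apply] at hcδ
    have h2 : (2 : E) * δ = 0 := by linear_combination hcδ
    exact hδ ((mul_eq_zero.mp h2).resolve_left two_ne_zero)
  obtain ⟨P, hP⟩ := exists_units_forall_valued_apply_eq E v
  obtain ⟨a, ha⟩ := exists_units_mul_conjLocal_eq E v c hcδ hδ P
  refine ⟨a, ?_, P, ha⟩
  have hsq := valued_pow_ramificationIdx'_eq_sq E v c hcδ hδ w hw P a ha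
  rw [ramificationIdx'_eq_two_of_ne_one E v c hc w hw he, hP w] at hsq
  have ha0 : Valued.v (a : v.adicCompletion F) ≠ 0 := (Valuation.ne_zero_iff _).2 a.ne_zero
  rw [← WithZero.exp_log ha0, ← WithZero.exp_nsmul, ← WithZero.exp_nsmul, WithZero.exp_inj, nsmul_eq_mul, nsmul_eq_mul] at hsq
  rw [← WithZero.exp_log ha0, mul_left_cancel₀ two_ne_zero hsq]

include hcδ hδ in
/-- **at a RAMIFIED non-split place some UNIT `u ∈ 𝒪_vˣ` is NOT a norm from `E_vˣ`**: otherwise, with the norm uniformiser `a` of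
`exists_isNorm_valued_eq_exp_neg_one_of_ramified`, every `b = (b · a^m) · a^{−m} ∈ F_vˣ` (`exp(m) = v_v(b)`, `b · a^m` a unit) would be a norm
(`isNorm_mul_zpow`), contradicting the index-`2` statement `…NonsplitPlace.exists_not_isNorm_of_nonsplit`.  So at a ramified place the norm
subgroup meets `𝒪_vˣ` in a proper subgroup (the local norm index of a ramified quadratic extension is carried by the units).
[cite: CasselsFrohlichANT1967, Ch. VI §1.1] [cite: Omeara1963, §63B Cor. 63:13a] -/
theorem exists_unit_not_isNorm_of_ramified (w : PlacesOver E v) (hw : c • w.1 = w.1)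
    (he : v.asIdeal.ramificationIdx' w.1.asIdeal ≠ 1) :
    ∃ u : (v.adicCompletion F)ˣ, Valued.v (u : v.adicCompletion F) = 1 ∧
      ¬ ∃ x : (LocalRing E v)ˣ, (x : LocalRing E v) * conjLocal E c v x = algebraMap (v.adicCompletion F) (LocalRing E v) u := by
  by_contra hall
  push Not at hall
  obtain ⟨a, hva, xa, hxa⟩ := exists_isNorm_valued_eq_exp_neg_one_of_ramified E v c hcδ hδ w hw he
  obtain ⟨b, hb⟩ := LemD1IndexedNonVacuityNonsplitPlace.exists_not_isNorm_of_nonsplit E v c hcδ hδ w hw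
  apply hb
  have hb0 : Valued.v (b : v.adicCompletion F) ≠ 0 := (Valuation.ne_zero_iff _).2 b.ne_zero
  set m : ℤ := WithZero.log (Valued.v (b : v.adicCompletion F)) with hm
  have hvb : Valued.v (b : v.adicCompletion F) = WithZero.exp m := by rw [hm, WithZero.exp_log hb0]
  have hu : Valued.v ((b * a ^ m : (v.adicCompletion F)ˣ) : v.adicCompletion F) = 1 := by
    rw [Units.val_mul, Units.val_zpow_eq_zpow_val, map_mul, map_zpow₀, hva, hvb, ← WithZero.exp_zsmul, ← WithZero.exp_add,
      smul_eq_mul, mul_neg, mul_one, add_neg_cancel, WithZero.exp_zero]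
  obtain ⟨y, hy⟩ := hall (b * a ^ m) hu
  refine ⟨y * xa ^ (-m), ?_⟩
  rw [isNorm_mul_zpow E v c hxa hy (-m), mul_assoc, ← zpow_add, add_neg_cancel, zpow_zero, mul_one]

/-! ## §4 Every Step-2 datum at a ramified non-split place is RAMIFIED -/

include hcδ hδ in
/-- **EVERY Step-2 datum takes the value `−1` at a UNIT of `F_v` at a ramified non-split place**: for `μ : E_vˣ → ℂˣ` with the printed clause
«`μ(ι_v a) = 1 ↔ a ∈ Nm E_vˣ`» (the rows' displayed binder shape `hμF`, nothing else is used) there is `u ∈ F_vˣ`, `v_v(u) = 1`, with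
`μ(ι_v u) = −1` (`≠ 1` at the non-norm unit of §3; square `1` since `u²` is a norm) — `μ ∘ ι_v` is a RAMIFIED quadratic character of `F_vˣ`.
[cite: Liu2021, App. D §D.1 Step 2 (l. 5219)] [cite: CasselsFrohlichANT1967, Ch. VI §1.1] -/
theorem exists_unit_apply_eq_neg_one_of_ramified (w : PlacesOver E v) (hw : c • w.1 = w.1)
    (he : v.asIdeal.ramificationIdx' w.1.asIdeal ≠ 1) (μ : (LocalRing E v)ˣ →* ℂˣ)
    (hμF : ∀ a : (v.adicCompletion F)ˣ,
      μ (Units.map (algebraMap (v.adicCompletion F) (LocalRing E v)).toMonoidHom a) = 1 ↔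
        ∃ x : (LocalRing E v)ˣ, (x : LocalRing E v) * conjLocal E c v x =
          algebraMap (v.adicCompletion F) (LocalRing E v) a) :
    ∃ u : (v.adicCompletion F)ˣ, Valued.v (u : v.adicCompletion F) = 1 ∧
      μ (Units.map (algebraMap (v.adicCompletion F) (LocalRing E v)).toMonoidHom u) = -1 := by
  obtain ⟨u, hvu, hu⟩ := exists_unit_not_isNorm_of_ramified E v c hcδ hδ w hw he
  refine ⟨u, hvu, ?_⟩
  have hne : μ (Units.map (algebraMap (v.adicCompletion F) (LocalRing E v)).toMonoidHom u) ≠ 1 :=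
    fun h => hu ((hμF u).1 h)
  have hsq : μ (Units.map (algebraMap (v.adicCompletion F) (LocalRing E v)).toMonoidHom u) ^ 2 = 1 := by
    rw [sq, ← map_mul, ← map_mul]
    exact (hμF (u * u)).2 ⟨_, units_map_mul_conjLocal E v c u⟩
  have h2 : (((μ (Units.map (algebraMap (v.adicCompletion F) (LocalRing E v)).toMonoidHom u) : ℂˣ) : ℂ)) ^ 2 = 1 := by
    rw [← Units.val_pow_eq_pow_val, hsq, Units.val_one]
  rcases sq_eq_one_iff.1 h2 with h | h
  · exact absurd (Units.ext h) hne
  · exact Units.ext (by rw [h, Units.val_neg, Units.val_one])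

include hcδ hδ in
/-- **… so EVERY Step-2 datum is RAMIFIED at `w`**: there is `u ∈ E_vˣ` with `v_w(u_w) = 1` and `μ u = −1` (`u = ι_v u₀`,
`v_w(ι_w u₀) = v_v(u₀)^e = 1`).  Contrast: at an inert place the rows' own `μ_v` is unramified for all but finitely many `v`
(`…InertCofinite`). [cite: Liu2021, App. D §D.1 Step 2 (l. 5219)] [cite: CasselsFrohlichANT1967, Ch. VI §1.1] -/
theorem exists_valued_eq_one_apply_eq_neg_one_of_ramified (w : PlacesOver E v) (hw : c • w.1 = w.1)
    (he : v.asIdeal.ramificationIdx' w.1.asIdeal ≠ 1) (μ : (LocalRing E v)ˣ →* ℂˣ)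
    (hμF : ∀ a : (v.adicCompletion F)ˣ,
      μ (Units.map (algebraMap (v.adicCompletion F) (LocalRing E v)).toMonoidHom a) = 1 ↔
        ∃ x : (LocalRing E v)ˣ, (x : LocalRing E v) * conjLocal E c v x =
          algebraMap (v.adicCompletion F) (LocalRing E v) a) :
    ∃ u : (LocalRing E v)ˣ, Valued.v ((u : LocalRing E v) w) = 1 ∧ μ u = -1 := by
  obtain ⟨u, hvu, hu⟩ := exists_unit_apply_eq_neg_one_of_ramified E v c hcδ hδ w hw he μ hμF
  refine ⟨Units.map (algebraMap (v.adicCompletion F) (LocalRing E v)).toMonoidHom u, ?_, hu⟩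
  rw [Units.coe_map, RingHom.toMonoidHom_eq_coe, MonoidHom.coe_coe, algebraMap_localRing_eq, toLocalRing_apply, valued_toPlace,
    hvu, one_pow]

include hcδ hδ in
/-- **… i.e. NO Step-2 datum at a ramified non-split place is unramified** (trivial on the units of `w`-valuation `1`) — the exact complement
of `…InertRigidity.stepTwo_eq_of_unramified` (at an inert place the unramified Step-2 datum exists for the CM rows and is unique).
[cite: Liu2021, App. D §D.1 Step 2 (l. 5219)] -/
theorem not_unramified_stepTwo_of_ramified (w : PlacesOver E v) (hw : c • w.1 = w.1)
    (he : v.asIdeal.ramificationIdx' w.1.asIdeal ≠ 1) (μ : (LocalRing E v)ˣ →* ℂˣ)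
    (hμF : ∀ a : (v.adicCompletion F)ˣ,
      μ (Units.map (algebraMap (v.adicCompletion F) (LocalRing E v)).toMonoidHom a) = 1 ↔
        ∃ x : (LocalRing E v)ˣ, (x : LocalRing E v) * conjLocal E c v x =
          algebraMap (v.adicCompletion F) (LocalRing E v) a) :
    ¬ ∀ u : (LocalRing E v)ˣ, Valued.v ((u : LocalRing E v) w) = 1 → μ u = 1 := by
  obtain ⟨u, hvu, hu⟩ := exists_valued_eq_one_apply_eq_neg_one_of_ramified E v c hcδ hδ w hw he μ hμF
  intro h
  rw [h u hvu] at hu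
  have h' := congrArg (fun z : ℂˣ => (z : ℂ)) hu
  simp only [Units.val_one, Units.val_neg] at h'
  norm_num at h'

include hcδ hδ in
/-- **… while `μ(ι_v a) = 1` at the NORM uniformiser `a` of §3** (at an inert place instead `μ(ι_v π) = −1` for every uniformiser `π`,
`…InertRigidity.stepTwo_apply_eq_neg_one_of_valued_eq`). [cite: Liu2021, App. D §D.1 Step 2 (l. 5219)] -/
theorem exists_valued_eq_apply_eq_one_of_ramified (w : PlacesOver E v) (hw : c • w.1 = w.1)
    (he : v.asIdeal.ramificationIdx' w.1.asIdeal ≠ 1) (μ : (LocalRing E v)ˣ →* ℂˣ)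
    (hμF : ∀ a : (v.adicCompletion F)ˣ,
      μ (Units.map (algebraMap (v.adicCompletion F) (LocalRing E v)).toMonoidHom a) = 1 ↔
        ∃ x : (LocalRing E v)ˣ, (x : LocalRing E v) * conjLocal E c v x =
          algebraMap (v.adicCompletion F) (LocalRing E v) a) :
    ∃ a : (v.adicCompletion F)ˣ, Valued.v (a : v.adicCompletion F) = WithZero.exp (-1 : ℤ) ∧
      μ (Units.map (algebraMap (v.adicCompletion F) (LocalRing E v)).toMonoidHom a) = 1 := by
  obtain ⟨a, hva, ha⟩ := exists_isNorm_valued_eq_exp_neg_one_of_ramified E v c hcδ hδ w hw he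
  exact ⟨a, hva, (hμF a).2 ha⟩

include hcδ hδ in
/-- **INERT OR RAMIFIED — the place model at an arbitrary non-split place**: either an inert witness exists (`v_w(ι_w π) = exp(−1)` for some
`π ∈ F_vˣ`: the setting of `…InertRigidity`, all but finitely many places by `…InertCofinite`), or `e(w|v) = 2`, `f(w|v) = 1` and every Step-2
datum is ramified at `w`. [cite: Liu2021, App. D §D.1 Step 2 (l. 5219)] [cite: NeukirchANT1999, Ch. I §8 Prop. (8.2)] -/
theorem exists_inertWitness_or_forall_stepTwo_ramified (w : PlacesOver E v) (hw : c • w.1 = w.1) :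
    (∃ π : (v.adicCompletion F)ˣ, Valued.v (toPlace v w (π : v.adicCompletion F)) = WithZero.exp (-1 : ℤ)) ∨
      (v.asIdeal.ramificationIdx' w.1.asIdeal = 2 ∧ w.1.asIdeal.inertiaDeg (𝓞 F) = 1 ∧
        ∀ (μ : (LocalRing E v)ˣ →* ℂˣ),
          (∀ a : (v.adicCompletion F)ˣ,
            μ (Units.map (algebraMap (v.adicCompletion F) (LocalRing E v)).toMonoidHom a) = 1 ↔
              ∃ x : (LocalRing E v)ˣ, (x : LocalRing E v) * conjLocal E c v x =
                algebraMap (v.adicCompletion F) (LocalRing E v) a) →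
          ∃ u : (LocalRing E v)ˣ, Valued.v ((u : LocalRing E v) w) = 1 ∧ μ u = -1) := by
  have hc : c ≠ 1 := by
    rintro rfl
    rw [AlgEquiv.one_apply] at hcδ
    have h2 : (2 : E) * δ = 0 := by linear_combination hcδ
    exact hδ ((mul_eq_zero.mp h2).resolve_left two_ne_zero)
  by_cases he : v.asIdeal.ramificationIdx' w.1.asIdeal = 1
  · exact Or.inl ((LemD1IndexedNonVacuityInertCofinite.exists_valued_toPlace_eq_iff_ramificationIdx'_eq_one E v w).2 he)
  · exact Or.inr ⟨ramificationIdx'_eq_two_of_ne_one E v c hc w hw he, inertiaDeg_eq_one_of_ne_one E v c hc w hw he,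
      fun μ hμF => exists_valued_eq_one_apply_eq_neg_one_of_ramified E v c hcδ hδ w hw he μ hμF⟩

variable (N : ℕ) (J : Matrix (Fin N) (Fin N) E) (hN : 2 ≤ N) (hJh : (J.map c)ᵀ = J) (hJdet : J.det ≠ 0)

/-- **`MuSet` form**: no element of the printed Step-2 index set `LemD1.MuSet (LemD1OfPlace.standingData E v c N J …)` of the place model is
unramified at a ramified non-split place. [cite: Liu2021, App. D §D.1 Step 2 (l. 5219)] -/
theorem not_unramified_muSet_of_ramified (w : PlacesOver E v) (hw : c • w.1 = w.1)
    (he : v.asIdeal.ramificationIdx' w.1.asIdeal ≠ 1)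
    (μ : LemD1.MuSet (LemD1OfPlace.standingData E v c N J hcδ hδ hN hJh hJdet)) :
    ¬ ∀ u : (LocalRing E v)ˣ, Valued.v ((u : LocalRing E v) w) = 1 → μ.1 u = 1 :=
  not_unramified_stepTwo_of_ramified E v c hcδ hδ w hw he μ.1 μ.2.2.2

end General

/-! ## §5 The CM rows: a conjugate-symplectic `ψ` is RAMIFIED at every place of `L` ramified over `L⁺` -/

section CM

open Literature.NumberTheory.GelbartRogawski1991.UnitaryDualPair (imagUnit complexConj_imagUnit imagUnit_ne_zero)
open Literature.NumberTheory.GelbartRogawski1991.UnitaryDualPair.LocalSplitting (localMu localMu_apply norm_localMu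
  continuous_localMu localMu_toLocalRing_eq_one_iff)
open Literature.NumberTheory.Automorphic.IdeleClassGroup (toHeckeCharacter isUnitary_toHeckeCharacter IsConjugateSymplectic)
open Literature.RepresentationTheory.Liu2021 (isOscillatorChar_toHeckeCharacter_iff)

variable (L : Type) [Field L] [NumberField L] [IsCMField L]

local notation3 "cc" => (IsCMField.complexConj L)
local notation3 "L⁺" => (↥(maximalRealSubfield L))

/-- **A CONJUGATE-SYMPLECTIC `ψ : C_L → S¹` IS RAMIFIED AT EVERY FINITE PLACE OF `L` RAMIFIED OVER `L⁺`**: if `e(w | w ∩ L⁺) ≠ 1` then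
`toHeckeCharacter L ψ` is NOT unramified at `w`.  Proof: such a `w` is fixed by complex conjugation (a place moved by `c` has `e = 1`, tree
`ramificationIdx'_eq_one_of_smul_ne`), the rows' own slot `μ_v = localMu L (toHeckeCharacter L ψ) v` (`v = w ∩ L⁺`) satisfies the printed Step-2
clause (tree `localMu_toLocalRing_eq_one_iff`), so by §4 `μ_v u = −1` at some `u ∈ E_vˣ` of `w`-valuation `1`, whereas `μ_v u = ψ_w(u_w) = 1` if
`ψ` were unramified at `w` (`μ_v(x) = ψ_w(x_w)` at a non-split place, tree `PlacesOver.prod_eq_of_smul_eq`).  So the ramification of `L/L⁺`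
lies INSIDE the ramification of every member of the displayed family. [cite: Liu2021, Def. 4.1; App. D §D.1 Step 2 (l. 5219)]
[cite: CasselsFrohlichANT1967, Ch. VI §1.1] -/
theorem not_isUnramifiedAt_toHeckeCharacter_of_ramificationIdx'_ne_one (ψ : IdeleClassGroup L →ₜ* Circle)
    (hψ : IsConjugateSymplectic L ψ) (w : HeightOneSpectrum (𝓞 L))
    (he : (w.under (𝓞 L⁺)).asIdeal.ramificationIdx' w.asIdeal ≠ 1) :
    ¬ (toHeckeCharacter L ψ).IsUnramifiedAt w := by
  intro hunr
  set v : HeightOneSpectrum (𝓞 L⁺) := w.under (𝓞 L⁺) with hv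
  have hw : cc • w = w := by
    by_contra hne
    exact he (ramificationIdx'_eq_one_of_smul_ne (maximalRealSubfield L) cc hne)
  let w' : PlacesOver L v := ⟨w, rfl⟩
  have hw' : cc • w'.1 = w'.1 := hw
  obtain ⟨u, hvu, hu⟩ := exists_valued_eq_one_apply_eq_neg_one_of_ramified L v cc (complexConj_imagUnit L) (imagUnit_ne_zero L)
    w' hw' he (localMu L (toHeckeCharacter L ψ) v)
    (fun t => localMu_toLocalRing_eq_one_iff L (toHeckeCharacter L ψ) v ((isOscillatorChar_toHeckeCharacter_iff ψ).mpr hψ) t)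
  have h1 : localMu L (toHeckeCharacter L ψ) v u = 1 := by
    rw [localMu_apply, PlacesOver.prod_eq_of_smul_eq cc (IsCMField.complexConj_ne_one L) w' hw']
    exact HeckeCharacter.isUnramifiedAt_iff_forall_valued_eq_one.1 hunr _ hvu
  rw [h1] at hu
  have h' := congrArg (fun z : ℂˣ => (z : ℂ)) hu
  simp only [Units.val_one, Units.val_neg] at h'
  norm_num at h'

/-- **… in Mathlib's currency `Algebra.IsUnramifiedAt`**: if `𝓞 L` is NOT unramified at `w` over `𝓞 L⁺`, then no conjugate-symplectic `ψ` is
unramified at `w`. [cite: Liu2021, Def. 4.1; App. D §D.1 Step 2 (l. 5219)] [cite: NeukirchANT1999, Ch. III §2 Thm. (2.6)] -/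
theorem not_isUnramifiedAt_toHeckeCharacter_of_not_isUnramifiedAt (ψ : IdeleClassGroup L →ₜ* Circle)
    (hψ : IsConjugateSymplectic L ψ) (w : HeightOneSpectrum (𝓞 L)) (hr : ¬ Algebra.IsUnramifiedAt (𝓞 L⁺) w.asIdeal) :
    ¬ (toHeckeCharacter L ψ).IsUnramifiedAt w :=
  not_isUnramifiedAt_toHeckeCharacter_of_ramificationIdx'_ne_one L ψ hψ w
    (ramificationIdx'_ne_one_of_not_isUnramifiedAt (F := L⁺) L (w.under (𝓞 L⁺)) ⟨w, rfl⟩ hr)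

/-- **… and in terms of the different**: every prime factor `w ∣ 𝔇_{L/L⁺}` is a ramified place of every conjugate-symplectic `ψ`
(Mathlib `dvd_differentIdeal_iff`). [cite: Liu2021, Def. 4.1; App. D §D.1 Step 2 (l. 5219)] [cite: NeukirchANT1999, Ch. III §2 Thm. (2.6)] -/
theorem not_isUnramifiedAt_toHeckeCharacter_of_dvd_differentIdeal (ψ : IdeleClassGroup L →ₜ* Circle)
    (hψ : IsConjugateSymplectic L ψ) (w : HeightOneSpectrum (𝓞 L))
    (hd : w.asIdeal ∣ differentIdeal (𝓞 L⁺) (𝓞 L)) : ¬ (toHeckeCharacter L ψ).IsUnramifiedAt w :=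
  not_isUnramifiedAt_toHeckeCharacter_of_not_isUnramifiedAt L ψ hψ w (dvd_differentIdeal_iff.mp hd)

/-- **contrapositive: a place of `L` at which some conjugate-symplectic `ψ` is unramified has `e(w | w ∩ L⁺) = 1`** — so the unramifiedness
binders `hunr` carried by `…InertRigidity` §3 already force the inert-witness hypothesis there (with `…InertCofinite.exists_valued_toPlace_eq_iff…`).
[cite: Liu2021, Def. 4.1; App. D §D.1 Step 2 (l. 5219)] -/
theorem ramificationIdx'_eq_one_of_isUnramifiedAt_toHeckeCharacter (ψ : IdeleClassGroup L →ₜ* Circle)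
    (hψ : IsConjugateSymplectic L ψ) (w : HeightOneSpectrum (𝓞 L)) (hunr : (toHeckeCharacter L ψ).IsUnramifiedAt w) :
    (w.under (𝓞 L⁺)).asIdeal.ramificationIdx' w.asIdeal = 1 := by
  by_contra he
  exact not_isUnramifiedAt_toHeckeCharacter_of_ramificationIdx'_ne_one L ψ hψ w he hunr

/-- **… hence at a non-split place where `ψ` is unramified an inert witness EXISTS** (the two hypotheses `hw : cc • w = w`, `hunr` of
`…InertRigidity.localMu_eq_localMu_of_inert_of_isUnramifiedAt` imply its third, the witness): the rows' own `μ_v` is then the unramified sign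
character there. [cite: Liu2021, Def. 4.1; App. D §D.1 Step 2 (l. 5219)] [cite: NeukirchANT1999, Ch. II §6 (before Prop. 6.8)] -/
theorem exists_inertWitness_of_isUnramifiedAt_toHeckeCharacter (ψ : IdeleClassGroup L →ₜ* Circle)
    (hψ : IsConjugateSymplectic L ψ) (v : HeightOneSpectrum (𝓞 L⁺)) (w : PlacesOver L v)
    (hunr : (toHeckeCharacter L ψ).IsUnramifiedAt w.1) :
    ∃ π : (v.adicCompletion L⁺)ˣ, Valued.v (toPlace v w (π : v.adicCompletion L⁺)) = WithZero.exp (-1 : ℤ) := by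
  refine (LemD1IndexedNonVacuityInertCofinite.exists_valued_toPlace_eq_iff_ramificationIdx'_eq_one (F := L⁺) L v w).2 ?_
  have h := ramificationIdx'_eq_one_of_isUnramifiedAt_toHeckeCharacter L ψ hψ w.1 hunr
  rwa [w.2] at h

/-- **the rigidity of `…InertRigidity` §3 with the witness hypothesis REMOVED**: for conjugate symplectic `ψ, ψ'`, a place `w ∣ v` fixed by
complex conjugation at which both Hecke characters are unramified, `localMu L (toHeckeCharacter L ψ) v = localMu L (toHeckeCharacter L ψ') v`
(the inert witness is supplied by `exists_inertWitness_of_isUnramifiedAt_toHeckeCharacter`).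
[cite: Liu2021, Def. 4.1; App. D §D.1 Step 2 (l. 5219), Lemma D.1 (3) (l. 5233)] -/
theorem localMu_eq_localMu_of_isUnramifiedAt (ψ ψ' : IdeleClassGroup L →ₜ* Circle) (hψ : IsConjugateSymplectic L ψ)
    (hψ' : IsConjugateSymplectic L ψ') (v : HeightOneSpectrum (𝓞 L⁺)) (w : PlacesOver L v) (hw : cc • w.1 = w.1)
    (hunr : (toHeckeCharacter L ψ).IsUnramifiedAt w.1) (hunr' : (toHeckeCharacter L ψ').IsUnramifiedAt w.1) :
    localMu L (toHeckeCharacter L ψ) v = localMu L (toHeckeCharacter L ψ') v := by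
  obtain ⟨π, hπ⟩ := exists_inertWitness_of_isUnramifiedAt_toHeckeCharacter L ψ hψ v w hunr
  exact LemD1IndexedNonVacuityInertRigidity.localMu_eq_localMu_of_inert_of_isUnramifiedAt L v ψ ψ' hψ hψ' w hw π hπ hunr hunr'

end CM

/-! ## §6 (v2) The CM rows: the FULL local component at a non-split place where `ψ` is unramified is the unramified sign
character `x ↦ (−1)^{ord_w x}`; the Frobenius value `ψ_w(ϖ_w) = −1` -/

section CMLocalComponent

open Literature.NumberTheory.GelbartRogawski1991.UnitaryDualPair (imagUnit complexConj_imagUnit imagUnit_ne_zero)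
open Literature.NumberTheory.GelbartRogawski1991.UnitaryDualPair.LocalSplitting (localMu localMu_apply)
open Literature.NumberTheory.Automorphic.IdeleClassGroup (toHeckeCharacter IsConjugateSymplectic)

variable (L : Type) [Field L] [NumberField L] [IsCMField L]

local notation3 "cc" => (IsCMField.complexConj L)
local notation3 "L⁺" => (↥(maximalRealSubfield L))

/-- **THE LOCAL COMPONENT OF A CONJUGATE-SYMPLECTIC `ψ` AT A NON-SPLIT PLACE WHERE IT IS UNRAMIFIED IS THE SIGN CHARACTER
`x ↦ (−1)^{ord_w x}`**: for `w` fixed by complex conjugation and `toHeckeCharacter L ψ` unramified at `w`, `ψ_w(x) = (−1)^{m}` with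
`exp(m) = v_w(x)` for every `x ∈ L_wˣ`.  Hypotheses are only `hw` and `hunr`: `hunr` forces `e(w | w ∩ L⁺) = 1` (§5), hence an inert
witness (`…InertCofinite`), and at the unit `u ∈ E_vˣ` of `E_v = Π_{w'' ∣ v} L_{w''} = L_w` with `w`-component `x` the rows' slot
`μ_v(u) = ψ_w(x)` is given by the closed form of `…InertRigidity`. [cite: Liu2021, Def. 4.1; App. D §D.1 Step 2 (l. 5219)]
[cite: NeukirchANT1999, Ch. II §6 (before Prop. 6.8)] -/
theorem localComponent_toHeckeCharacter_eq_neg_one_zpow_of_isUnramifiedAt (ψ : IdeleClassGroup L →ₜ* Circle)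
    (hψ : IsConjugateSymplectic L ψ) (w : HeightOneSpectrum (𝓞 L)) (hw : cc • w = w)
    (hunr : (toHeckeCharacter L ψ).IsUnramifiedAt w) (x : (w.adicCompletion L)ˣ) :
    (toHeckeCharacter L ψ).localComponent w x = (-1 : ℂˣ) ^ WithZero.log (Valued.v (x : w.adicCompletion L)) := by
  set v : HeightOneSpectrum (𝓞 L⁺) := w.under (𝓞 L⁺) with hv
  let w' : PlacesOver L v := ⟨w, rfl⟩
  have hw' : cc • w'.1 = w'.1 := hw
  have hc : cc ≠ 1 := IsCMField.complexConj_ne_one L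
  obtain ⟨π, hπ⟩ := exists_inertWitness_of_isUnramifiedAt_toHeckeCharacter L ψ hψ v w' hunr
  classical
  -- the unit of `E_v = Π_{w'' ∣ v} L_{w''}` with `w`-component `x` (and `1` elsewhere — there is no elsewhere)
  set g : (w'' : PlacesOver L v) → (w''.1.adicCompletion L)ˣ := Pi.mulSingle w' x with hg
  set u : (LocalRing L v)ˣ := MulEquiv.piUnits.symm g with hu
  have hux : Units.map (Pi.evalMonoidHom (fun w'' : PlacesOver L v => w''.1.adicCompletion L) w') u = x := by
    apply Units.ext
    change ((g w' : (w'.1.adicCompletion L)ˣ) : w'.1.adicCompletion L) = x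
    rw [hg, Pi.mulSingle_eq_same]
  have hux' : ((u : LocalRing L v) w') = (x : w.adicCompletion L) := congrArg Units.val hux
  have hμ := LemD1IndexedNonVacuityInertRigidity.localMu_apply_eq_neg_one_zpow_of_inert_of_isUnramifiedAt L v ψ hψ w' hw'
    π hπ hunr u
  rw [localMu_apply, PlacesOver.prod_eq_of_smul_eq cc hc w' hw', hux, hux'] at hμ
  rw [HeckeCharacter.localComponent_apply]
  exact hμ

/-- **THE FROBENIUS VALUE `ψ_w(ϖ_w) = −1`**: at a place `w` of `L` fixed by complex conjugation where the conjugate-symplectic `ψ` is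
unramified, the value of `toHeckeCharacter L ψ` at (any) uniformiser of `L_w` is `−1` (tree `HeckeCharacter.valueAtUniformizer`; `ord_w ϖ_w = 1`).
[cite: Liu2021, Def. 4.1; App. D §D.1 Step 2 (l. 5219)] [cite: NeukirchANT1999, Ch. II §6 (before Prop. 6.8)] -/
theorem valueAtUniformizer_toHeckeCharacter_eq_neg_one_of_isUnramifiedAt (ψ : IdeleClassGroup L →ₜ* Circle)
    (hψ : IsConjugateSymplectic L ψ) (w : HeightOneSpectrum (𝓞 L)) (hw : cc • w = w)
    (hunr : (toHeckeCharacter L ψ).IsUnramifiedAt w) : (toHeckeCharacter L ψ).valueAtUniformizer w = -1 := by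
  rw [HeckeCharacter.valueAtUniformizer, localComponent_toHeckeCharacter_eq_neg_one_zpow_of_isUnramifiedAt L ψ hψ w hw hunr,
    HeckeCharacter.valued_uniformizer, WithZero.log_exp, zpow_neg, zpow_one, inv_neg_one, Units.val_neg, Units.val_one]

/-- **… at ALL BUT FINITELY MANY non-split places**: for all but finitely many finite places `w` of `L`, if `w` is fixed by complex
conjugation then `ψ_w(ϖ_w) = −1` (tree `HeckeCharacter.isUnramifiedAt_cofinite_holds`). [cite: Liu2021, Def. 4.1; App. D §D.1 Step 2 (l. 5219)]
[cite: TateThesis1967, Lemma 3.2.1] -/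
theorem eventually_valueAtUniformizer_toHeckeCharacter_eq_neg_one (ψ : IdeleClassGroup L →ₜ* Circle)
    (hψ : IsConjugateSymplectic L ψ) :
    ∀ᶠ w : HeightOneSpectrum (𝓞 L) in Filter.cofinite, cc • w = w → (toHeckeCharacter L ψ).valueAtUniformizer w = -1 := by
  have h : ∀ᶠ w : HeightOneSpectrum (𝓞 L) in Filter.cofinite, (toHeckeCharacter L ψ).IsUnramifiedAt w :=
    HeckeCharacter.isUnramifiedAt_cofinite_holds (toHeckeCharacter L ψ)
  exact h.mono fun w hunr hw => valueAtUniformizer_toHeckeCharacter_eq_neg_one_of_isUnramifiedAt L ψ hψ w hw hunr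

/-- **… and the local component is QUADRATIC and NON-TRIVIAL there**: `ψ_w² = 1` (`…PlaceDichotomy`) with `ψ_w ≠ 1` — at a non-split
place where `ψ` is unramified, `ψ_w` has order EXACTLY `2`. [cite: Liu2021, Def. 4.1; App. D §D.1 Step 2 (l. 5219)] -/
theorem localComponent_toHeckeCharacter_ne_one_of_isUnramifiedAt (ψ : IdeleClassGroup L →ₜ* Circle)
    (hψ : IsConjugateSymplectic L ψ) (w : HeightOneSpectrum (𝓞 L)) (hw : cc • w = w)
    (hunr : (toHeckeCharacter L ψ).IsUnramifiedAt w) : (toHeckeCharacter L ψ).localComponent w ≠ 1 := by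
  intro h
  have h1 := valueAtUniformizer_toHeckeCharacter_eq_neg_one_of_isUnramifiedAt L ψ hψ w hw hunr
  rw [HeckeCharacter.valueAtUniformizer, h, MonoidHom.one_apply, Units.val_one] at h1
  norm_num at h1

end CMLocalComponent

/-! ## §7 (v3) Synthesis for the rows: EXPLICIT exceptional sets — the ramification of `L/L⁺` lies in `ramifiedPlaces ψ`, and the
non-split places where two members' μ-labels differ lie below `ramifiedPlaces ψ ∪ ramifiedPlaces ψ'` -/

section CMSynthesis

open Literature.NumberTheory.GelbartRogawski1991.UnitaryDualPair (imagUnit complexConj_imagUnit imagUnit_ne_zero)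
open Literature.NumberTheory.GelbartRogawski1991.UnitaryDualPair.LocalSplitting (localMu localMu_apply norm_localMu
  continuous_localMu localMu_toLocalRing_eq_one_iff)
open Literature.NumberTheory.Automorphic.IdeleClassGroup (toHeckeCharacter isUnitary_toHeckeCharacter IsConjugateSymplectic)
open Literature.RepresentationTheory.Liu2021 (isOscillatorChar_toHeckeCharacter_iff)

variable (L : Type) [Field L] [NumberField L] [IsCMField L]

local notation3 "cc" => (IsCMField.complexConj L)
local notation3 "L⁺" => (↥(maximalRealSubfield L))

/-- **the places of `L` ramified over `L⁺` lie in the set of ramified places of every conjugate-symplectic `ψ`** (tree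
`HeckeCharacter.ramifiedPlaces = {w | ¬ IsUnramifiedAt w}`; §5 as an inclusion of sets — the finite support of `𝔇_{L/L⁺}` divides the
conductor of every member of the displayed family). [cite: Liu2021, Def. 4.1; App. D §D.1 Step 2 (l. 5219)] [cite: NeukirchANT1999, Ch. III §2 Thm. (2.6)] -/
theorem setOf_ramificationIdx'_ne_one_subset_ramifiedPlaces (ψ : IdeleClassGroup L →ₜ* Circle) (hψ : IsConjugateSymplectic L ψ) :
    {w : HeightOneSpectrum (𝓞 L) | (w.under (𝓞 L⁺)).asIdeal.ramificationIdx' w.asIdeal ≠ 1} ⊆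
      (toHeckeCharacter L ψ).ramifiedPlaces :=
  fun w hw => not_isUnramifiedAt_toHeckeCharacter_of_ramificationIdx'_ne_one L ψ hψ w hw

/-- **… in terms of the different: `{w : w ∣ 𝔇_{L/L⁺}} ⊆ ramifiedPlaces ψ`.** [cite: Liu2021, Def. 4.1; App. D §D.1 Step 2 (l. 5219)]
[cite: NeukirchANT1999, Ch. III §2 Thm. (2.6)] -/
theorem setOf_dvd_differentIdeal_subset_ramifiedPlaces (ψ : IdeleClassGroup L →ₜ* Circle) (hψ : IsConjugateSymplectic L ψ) :
    {w : HeightOneSpectrum (𝓞 L) | w.asIdeal ∣ differentIdeal (𝓞 L⁺) (𝓞 L)} ⊆ (toHeckeCharacter L ψ).ramifiedPlaces :=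
  fun w hw => not_isUnramifiedAt_toHeckeCharacter_of_dvd_differentIdeal L ψ hψ w hw

/-- **THE EXCEPTIONAL SET OF `…InertCofinite.finite_nonsplit_localMu_ne` MADE EXPLICIT**: the non-split places `v` of `L⁺` at which the
μ-labels of two conjugate-symplectic members `ψ, ψ'` DIFFER lie below the ramified places of `toHeckeCharacter ψ` or of `toHeckeCharacter ψ'`
— the ramification of `L/L⁺` need not be listed separately (§5: it is inside both), and at a non-split place with both unramified the labels
agree (`localMu_eq_localMu_of_isUnramifiedAt`). [cite: Liu2021, Def. 4.1; App. D §D.1 Step 2 (l. 5219), Lemma D.1 (3) (l. 5233)]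
[cite: TateThesis1967, Lemma 3.2.1] -/
theorem setOf_nonsplit_localMu_ne_subset_image_ramifiedPlaces (ψ ψ' : IdeleClassGroup L →ₜ* Circle)
    (hψ : IsConjugateSymplectic L ψ) (hψ' : IsConjugateSymplectic L ψ') :
    {v : HeightOneSpectrum (𝓞 L⁺) | ∃ w : PlacesOver L v, cc • w.1 = w.1 ∧
        localMu L (toHeckeCharacter L ψ) v ≠ localMu L (toHeckeCharacter L ψ') v} ⊆
      (fun w : HeightOneSpectrum (𝓞 L) => w.under (𝓞 L⁺)) ''
        ((toHeckeCharacter L ψ).ramifiedPlaces ∪ (toHeckeCharacter L ψ').ramifiedPlaces) := by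
  rintro v ⟨w, hw, hne⟩
  by_cases h₁ : (toHeckeCharacter L ψ).IsUnramifiedAt w.1
  · by_cases h₂ : (toHeckeCharacter L ψ').IsUnramifiedAt w.1
    · exact absurd (localMu_eq_localMu_of_isUnramifiedAt L ψ ψ' hψ hψ' v w hw h₁ h₂) hne
    · exact ⟨w.1, Set.mem_union_right _ h₂, w.2⟩
  · exact ⟨w.1, Set.mem_union_left _ h₁, w.2⟩

variable (N : ℕ) (J : Matrix (Fin N) (Fin N) L) (hN : 2 ≤ N) (hJh : (J.map (IsCMField.complexConj L))ᵀ = J) (hJdet : J.det ≠ 0)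

/-- **the packaged labels coincide at a non-split place where both members are unramified** — `…InertRigidity.muOf_localMu_eq_of_inert_of_isUnramifiedAt`
with the inert-witness hypothesis REMOVED. [cite: Liu2021, App. D §D.1 Step 2 (l. 5219), Lemma D.1 (3) (l. 5233)] -/
theorem muOf_localMu_eq_of_isUnramifiedAt (ψ ψ' : IdeleClassGroup L →ₜ* Circle) (hψ : IsConjugateSymplectic L ψ)
    (hψ' : IsConjugateSymplectic L ψ') (v : HeightOneSpectrum (𝓞 L⁺)) (w : PlacesOver L v) (hw : cc • w.1 = w.1)
    (hunr : (toHeckeCharacter L ψ).IsUnramifiedAt w.1) (hunr' : (toHeckeCharacter L ψ').IsUnramifiedAt w.1) :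
    LemD1OfPlace.muOf L v cc N J (complexConj_imagUnit L) (imagUnit_ne_zero L) hN hJh hJdet
        (localMu L (toHeckeCharacter L ψ) v)
        (fun x => norm_localMu L (toHeckeCharacter L ψ) v (isUnitary_toHeckeCharacter L ψ) x)
        (continuous_localMu L (toHeckeCharacter L ψ) v)
        (fun t => localMu_toLocalRing_eq_one_iff L (toHeckeCharacter L ψ) v ((isOscillatorChar_toHeckeCharacter_iff ψ).mpr hψ) t) =
      LemD1OfPlace.muOf L v cc N J (complexConj_imagUnit L) (imagUnit_ne_zero L) hN hJh hJdet
        (localMu L (toHeckeCharacter L ψ') v)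
        (fun x => norm_localMu L (toHeckeCharacter L ψ') v (isUnitary_toHeckeCharacter L ψ') x)
        (continuous_localMu L (toHeckeCharacter L ψ') v)
        (fun t => localMu_toLocalRing_eq_one_iff L (toHeckeCharacter L ψ') v
          ((isOscillatorChar_toHeckeCharacter_iff ψ').mpr hψ') t) :=
  Subtype.ext (localMu_eq_localMu_of_isUnramifiedAt L ψ ψ' hψ hψ' v w hw hunr hunr')

end CMSynthesis

end Literature.NumberTheory.Automorphic.Liu2021.LemD1IndexedNonVacuityRamifiedPlace

end
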